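import Summits.QuantumFields.BalabanUV.Beta.EriceFlowEnclosureB12AsPrintedHistoryContagionShiftFlowRepinTail
import Summits.QuantumFields.BalabanUV.Beta.EriceFlowEnclosureB12AsPrintedHistoryContagionShiftFlowPicardEnd

/-!
# Beta / EriceFlowEnclosureB12AsPrintedHistoryContagionShiftFlowRepinEnd — ASYMPTOTIC FREEDOM IS CONTAGIOUS, part 26 (the re-pinning END): THEOREM 2's CONTINUUM
# TRAJECTORY IS RG-INVARIANT — FROM THEOREM 2 AS TYPED.  Parts 23–25 read on the as-printed carrier.  From `Theorem2Statement S hL` (a HYPOTHESIS) + `hrg` on ]0, γ_u] +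
# NE4 `ScaleShiftRate c θ γ_u S.β` + `HistLipschitz Λ γ_u S.β` with `FadingMemory C θ Λ` (0 < θ < 1; γ_u ARBITRARY against (C, θ)), for every torus exponent m:
# (§38) there is g₁₆ > 0 such that for EVERY g ∈ ]0, g₁₆] and EVERY physical scale n — **`solution (betaInf S.β) (solution (betaInf S.β) g n) m′ = solution (betaInf S.β) g (n + m′)`**
# (THE COCYCLE of node U2's lattice-free solution operator on the carrier), the flow RE-PINNED at the running value `solution (betaInf S.β) g n` has EXACTLY ONE box solution
# (its tail), and for EVERY family of Theorem-2-type rows in ]0, γ_u] pinned at g the continuum running coupling obeys **`gstar rows (n + m′) = solution (betaInf S.β)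
# (gstar rows n) m′`**: re-pinning Theorem 2's continuum trajectory at ANY of its own running couplings and solving the limit RG equation lattice-free from there
# REPRODUCES the trajectory — the renormalization-group invariance of the continuum running coupling of [I] Theorem 2's «g₀(ε, g)», with the two thresholds of parts 20 ∕ 22
# merged into one (same-pin uniqueness, part 23), and **`gstar rows n = R^[n] g`** with the lattice-free ONE-STEP RENORMALIZATION MAP `R x = solution (betaInf S.β) x 1`:
# THE CONTINUUM RUNNING COUPLING IS THE ORBIT OF ONE MAP ON COUPLING SPACE, the memory notwithstanding; (§39) WITH NO SMALLNESS beyond part 6's existence threshold g₂: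
# for EVERY row family pinned at g_IR ≤ g₂ there is a scale n₀ beyond which the continuum trajectory `gstar rows` is the unique box solution of its own re-pinned flow, equal
# to node U2's `solution (betaInf S.β) (gstar rows n)` and computed by node U2's Picard iteration from the constant history `gstar rows n` (part 25's `eventually_wellPosed_tail`).
# (β-flow team, prover 1, unit `b2b-balaban-beta-bflow-p1`, gen 38; ROW AP-I·Uc × NODE U2 — the re-pinning END)

HONEST FRAMING (page 1 of everything the β sub-cell writes): discharging `BetaPertH` makes Bałaban's UV stability UNCONDITIONAL — a
real constructive-QFT result; it is NOT the continuum limit and NOT the Clay problem.  HONEST DEPENDENCY (cell reorg 2026-08-19,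
verbatim): «continuum YM on T⁴ ⇐ BetaPertH ∧ nine spine estimates (0/9 proved); BetaPertH ⇐ (D1) ∧ (D4) ∧ CAP+tail; G-an2-4 gates
asym, D1 and NE2/3/4.»  THIS MODULE DISCHARGES NOTHING: it is BOOKKEEPING BY NAME — part 15's `reference_of_typedTheorem2` (the as-printed reference: ONE box solution of
`MemFlow (betaInf S.β) g_r ·` with the profile `1∕(2g_r)² + b·m′`, from parts 6 ∕ 11), part 6's `continuumCoupling_bigBox_of_typedTheorem2 ∕ memFlow_bigBox_of_typedTheorem2`,
part 11's `flow_threshold_exists`, part 13's `eq_solution_of_memFlow_of_reference`, part 25's `solution_cocycle_of_reference ∕ eventually_wellPosed_tail`, node U2's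
`memoryProfile_betaInf ∕ one_div_gstar_sq`.  `Theorem2Statement S hL` ([I] THEOREM 2 p. 259, STATED WITHOUT PROOF there — typed by `b2b-balaban-beta-asprinted`, NOT proved
here or anywhere in the tree), `hrg` (the runs (0.20) p. 256 of the Setting's coupling function), NE4 `ScaleShiftRate` (GAPS G-t4-U2-1: [I] has NO statement on the
k-dependence of β_k, p. 298), `HistLipschitz` ∕ `FadingMemory` (GAPS G-t4-U2-2) are HYPOTHESES about an abstract `S : Setting` — none is asserted for Bałaban's actual β;
«continuum running coupling» = the K → ∞ limit of the effective couplings of (0.20) at fixed physical scale, NOT the continuum limit of the measures.  [I] = T. Bałaban,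
Commun. Math. Phys. **109** (1987) 249–301 [Balaban1987RG1].

WHAT THIS FILE PROVES (0 sorry, 0 def): §38 **`solution_cocycle_of_typedTheorem2`**, **`gstar_cocycle_of_typedTheorem2`**, **`gstar_eq_orbit_of_typedTheorem2`**; §39
**`eventually_wellPosed_of_typedTheorem2`**.
NOT CLAIMED: Theorem 2; anything about Bałaban's β; `BetaPertH`; the continuum limit of the measures; Clay.
-/

namespace Summit.QuantumFields.BalabanUV.Beta.EriceFlowEnclosureB12AsPrintedHistoryContagionShiftFlowRepinEnd

open Finset Filter Topology
open Literature.MathematicalPhysics.QuantumFieldTheory.Balaban1983to89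
open Literature.MathematicalPhysics.QuantumFieldTheory.Balaban1983to89.B12BetaAsPrinted
open Literature.MathematicalPhysics.QuantumFieldTheory.Balaban1983to89.FlowStep (RGEqH)
open Literature.MathematicalPhysics.QuantumFieldTheory.Balaban1983to89.T4CouplingMatching (HistLipschitz FadingMemory ScaleShiftRate disc)
open Literature.MathematicalPhysics.QuantumFieldTheory.Balaban1983to89.T4CauchySum (InjectedRate)
open Literature.MathematicalPhysics.QuantumFieldTheory.Balaban1983to89.T4ContinuumCoupling (astar gstar)
open Literature.MathematicalPhysics.QuantumFieldTheory.Balaban1983to89.T4BetaStationary (SeqBox betaInf memoryProfile_betaInf)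
open Literature.MathematicalPhysics.QuantumFieldTheory.Balaban1983to89.T4BetaFlowWellPosed (MemFlow iterate solution)
open Summit.QuantumFields.BalabanUV.Beta.EriceFlowEnclosureB12AsPrintedHistoryContagionShiftEnd (continuumCoupling_bigBox_of_typedTheorem2
  memFlow_bigBox_of_typedTheorem2)
open Summit.QuantumFields.BalabanUV.Beta.EriceFlowEnclosureB12AsPrintedHistoryContagionShiftFlowEnd (flow_threshold_exists)
open Summit.QuantumFields.BalabanUV.Beta.EriceFlowEnclosureB12AsPrintedHistoryContagionShiftFlowPicardLimit (eq_solution_of_memFlow_of_reference)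
open Summit.QuantumFields.BalabanUV.Beta.EriceFlowEnclosureB12AsPrintedHistoryContagionShiftFlowPicardEnd (reference_of_typedTheorem2)
open Summit.QuantumFields.BalabanUV.Beta.EriceFlowEnclosureB12AsPrintedHistoryContagionShiftFlowRepinTail (solution_cocycle_of_reference eventually_wellPosed_tail
  solution_eq_orbit_of_reference)

noncomputable section

variable {S : Setting}

/-! ## §38 The cocycle on the carrier: re-pinning Theorem 2's continuum trajectory reproduces it -/

/-- **THE COCYCLE OF NODE U2's SOLUTION OPERATOR ON THE CARRIER — FROM THEOREM 2 AS TYPED.**  `Theorem2Statement S hL` (a HYPOTHESIS), `hrg` on ]0, γ_u], NE4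
`ScaleShiftRate c θ γ_u S.β` (c ≥ 0), `HistLipschitz Λ γ_u S.β` with `FadingMemory C θ Λ` (0 < θ < 1, C ≥ 0; γ_u ARBITRARY against (C, θ)) ⟹ for every torus exponent m there is
g₁₆ > 0 such that for EVERY g ∈ ]0, g₁₆] and EVERY scale n: (i) `solution (betaInf S.β) (solution (betaInf S.β) g n) m′ = solution (betaInf S.β) g (n + m′)` for all m′;
(ii) every box solution of the flow re-pinned at the running value `solution (betaInf S.β) g n` is the tail `(solution (betaInf S.β) g (n + ·))` — ONE threshold for existence and
uniqueness (part 25's `solution_cocycle_of_reference` with part 15's as-printed reference). [cite: Balaban1987RG1, Thm 2 (0.31) p.259 with (0.20) p.256 and §5 p.298] -/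
theorem solution_cocycle_of_typedTheorem2 {hL : Odd S.L ∧ 1 < S.L} (h : Theorem2Statement S hL)
    {γu θ C c : ℝ} {Λ : ℕ → ℕ → ℝ} (hγu : 0 < γu)
    (hrg : ∀ P : B12.RunParams, Step.InInterval γu P.K (S.cpl P) → RGEqH P.K S.β (S.cpl P))
    (hS : ScaleShiftRate c θ γu S.β) (hL' : HistLipschitz Λ γu S.β) (hΛ : FadingMemory C θ Λ)
    (hθ0 : 0 < θ) (hθ1 : θ < 1) (hC : 0 ≤ C) (hc : 0 ≤ c) (m : ℕ) :
    ∃ g₁₆ : ℝ, 0 < g₁₆ ∧ ∀ g : ℝ, 0 < g → g ≤ g₁₆ → ∀ n : ℕ,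
      (∀ m' : ℕ, solution (betaInf S.β) (solution (betaInf S.β) g n) m' = solution (betaInf S.β) g (n + m')) ∧
      (∀ h' : ℕ → ℝ, SeqBox γu h' → MemFlow (betaInf S.β) (solution (betaInf S.β) g n) h' → h' = fun j => solution (betaInf S.β) g (n + j)) := by
  have h1θ : 0 < 1 - θ := by linarith
  have hB := memoryProfile_betaInf hS hL' hΛ hθ0.le hθ1
  obtain ⟨gr, b, g₂, g₃, t, hgr, hb, -, -, htbox, htflow, hprof, -, -⟩ :=
    reference_of_typedTheorem2 h hγu hrg hS hL' hΛ hθ0 hθ1 hC hc m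
  have h2gr : 0 < 2 * gr := by positivity
  have h8C : 0 ≤ 8 * C := by positivity
  obtain ⟨e₀, he₀, hthr⟩ := flow_threshold_exists (1 / gr ^ 2 + C * γu / (1 - θ) ^ 2 + (2 * C / ((1 - θ) * b)) ^ 2) hC hθ1 hb
  obtain ⟨e₁, he₁, hthr'⟩ := flow_threshold_exists (6 * (C * γu / (1 - θ) ^ 2 + (8 * C / ((1 - θ) * b)) ^ 2)) h8C hθ1 hb
  refine ⟨min e₀ (min e₁ (γu / 4)), lt_min he₀ (lt_min he₁ (by positivity)), fun g hg hle n => ?_⟩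
  obtain ⟨-, hs2, -⟩ := hthr g hg (hle.trans (min_le_left _ _))
  obtain ⟨hs1', hs2', hs4'⟩ := hthr' g hg (hle.trans ((min_le_right _ _).trans (min_le_left _ _)))
  have h4g : 4 * g ≤ γu := by linarith [hle.trans ((min_le_right _ _).trans (min_le_right _ _))]
  exact solution_cocycle_of_reference hB hC hθ0.le hθ1 hb h2gr htbox htflow hprof hg h4g (by linarith) hs2 (by linarith) (by linarith) n

/-- **THEOREM 2's CONTINUUM TRAJECTORY IS RG-INVARIANT — FROM THEOREM 2 AS TYPED.**  Under the data of `solution_cocycle_of_typedTheorem2`, for every torus exponent m there is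
g₁₆ > 0 such that for EVERY g ∈ ]0, g₁₆], EVERY family `rows` of Theorem-2-type rows in ]0, γ_u] pinned at g (`rows K K = g`), and EVERY physical scale n:
**`gstar rows (n + m′) = solution (betaInf S.β) (gstar rows n) m′`** for all m′ — the continuum running coupling of [I] Theorem 2's «g₀(ε, g)» n + m′ scales into the ultraviolet
equals node U2's lattice-free solution of the limit RG equation started m′ scales from the trajectory's OWN running coupling at scale n; and the flow re-pinned at
`gstar rows n` has exactly one box solution.  (`gstar rows = solution (betaInf S.β) g` by part 13's uniqueness against the as-printed reference, then §38 (i).)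
[cite: Balaban1987RG1, Thm 2 (0.31) p.259 with (0.20) p.256 and §5 p.298] -/
theorem gstar_cocycle_of_typedTheorem2 {hL : Odd S.L ∧ 1 < S.L} (h : Theorem2Statement S hL)
    {γu θ C c : ℝ} {Λ : ℕ → ℕ → ℝ} (hγu : 0 < γu)
    (hrg : ∀ P : B12.RunParams, Step.InInterval γu P.K (S.cpl P) → RGEqH P.K S.β (S.cpl P))
    (hS : ScaleShiftRate c θ γu S.β) (hL' : HistLipschitz Λ γu S.β) (hΛ : FadingMemory C θ Λ)
    (hθ0 : 0 < θ) (hθ1 : θ < 1) (hC : 0 ≤ C) (hc : 0 ≤ c) (m : ℕ) :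
    ∃ g₁₆ : ℝ, 0 < g₁₆ ∧ ∀ (g : ℝ) (rows : ℕ → ℕ → ℝ), 0 < g → g ≤ g₁₆ →
      (∀ K, ∃ (m' : ℕ) (g₀ : ℝ), rows K = S.cpl ⟨K, m', g₀⟩) → (∀ K, Step.InInterval γu K (rows K)) → (∀ K, rows K K = g) → ∀ n : ℕ,
      (∀ m' : ℕ, gstar rows (n + m') = solution (betaInf S.β) (gstar rows n) m') ∧
      (∃! h' : ℕ → ℝ, SeqBox γu h' ∧ MemFlow (betaInf S.β) (gstar rows n) h') := by
  have h1θ : 0 < 1 - θ := by linarith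
  have hB := memoryProfile_betaInf hS hL' hΛ hθ0.le hθ1
  obtain ⟨gr, b, g₂, g₃, t, hgr, hb, hg₂, -, htbox, htflow, hprof, hmem, -⟩ :=
    reference_of_typedTheorem2 h hγu hrg hS hL' hΛ hθ0 hθ1 hC hc m
  have h2gr : 0 < 2 * gr := by positivity
  have h8C : 0 ≤ 8 * C := by positivity
  obtain ⟨e₀, he₀, hthr⟩ := flow_threshold_exists (1 / gr ^ 2 + C * γu / (1 - θ) ^ 2 + (2 * C / ((1 - θ) * b)) ^ 2) hC hθ1 hb
  obtain ⟨e₁, he₁, hthr'⟩ := flow_threshold_exists (6 * (C * γu / (1 - θ) ^ 2 + (8 * C / ((1 - θ) * b)) ^ 2)) h8C hθ1 hb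
  refine ⟨min e₀ (min e₁ (min (γu / 4) g₂)), lt_min he₀ (lt_min he₁ (lt_min (by positivity) hg₂)), fun g rows hg hle hrow hI hpin n => ?_⟩
  obtain ⟨hs1, hs2, hs4⟩ := hthr g hg (hle.trans (min_le_left _ _))
  obtain ⟨hs1', hs2', hs4'⟩ := hthr' g hg (hle.trans ((min_le_right _ _).trans (min_le_left _ _)))
  have h4g : 4 * g ≤ γu := by linarith [hle.trans ((min_le_right _ _).trans ((min_le_right _ _).trans (min_le_left _ _)))]
  have hle2 : g ≤ g₂ := hle.trans ((min_le_right _ _).trans ((min_le_right _ _).trans (min_le_right _ _)))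
  have h2g : 2 * g ≤ γu := by linarith
  obtain ⟨hbox, hflow⟩ := hmem rows g hrow hI hpin hle2
  have hgs : gstar rows = solution (betaInf S.β) g :=
    eq_solution_of_memFlow_of_reference hB hC hθ0.le hθ1 hb h2gr htbox htflow hprof hg h2g hs1 hs2 hs4 hbox hflow
  obtain ⟨hcoc, huniq⟩ :=
    solution_cocycle_of_reference hB hC hθ0.le hθ1 hb h2gr htbox htflow hprof hg h4g (by linarith) hs2 (by linarith) (by linarith) n
  refine ⟨fun m' => by rw [hgs, hcoc m'], ?_⟩
  rw [hgs]
  exact ⟨fun j => solution (betaInf S.β) g (n + j),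
    ⟨T4BetaFlowWellPosed.seqBox_shift (hgs ▸ hbox) n, EriceRemainderEnclosureHistoryAutonomyOrder.memFlow_tail (hgs ▸ hflow) n⟩,
    fun h' hh' => huniq h' hh'.1 hh'.2⟩

/-- **THEOREM 2's CONTINUUM RUNNING COUPLING IS THE ORBIT OF ONE MAP ON COUPLING SPACE — FROM THEOREM 2 AS TYPED.**  Under the data of `solution_cocycle_of_typedTheorem2`,
for every torus exponent m there is g₁₆ > 0 such that for EVERY g ∈ ]0, g₁₆], EVERY family `rows` of Theorem-2-type rows in ]0, γ_u] pinned at g and EVERY n: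
**`gstar rows n = R^[n] g`** with the LATTICE-FREE ONE-STEP RENORMALIZATION MAP `R x := solution (betaInf S.β) x 1` — the continuum running coupling of [I] Theorem 2's
«g₀(ε, g)» n scales into the ultraviolet is the n-th iterate of ONE map of the renormalized coupling, the memory of the limit RG equation notwithstanding (part 25's
`solution_eq_orbit_of_reference` + part 13's identification). [cite: Balaban1987RG1, Thm 2 (0.31) p.259 with (0.20) p.256 and §5 p.298] -/
theorem gstar_eq_orbit_of_typedTheorem2 {hL : Odd S.L ∧ 1 < S.L} (h : Theorem2Statement S hL)
    {γu θ C c : ℝ} {Λ : ℕ → ℕ → ℝ} (hγu : 0 < γu)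
    (hrg : ∀ P : B12.RunParams, Step.InInterval γu P.K (S.cpl P) → RGEqH P.K S.β (S.cpl P))
    (hS : ScaleShiftRate c θ γu S.β) (hL' : HistLipschitz Λ γu S.β) (hΛ : FadingMemory C θ Λ)
    (hθ0 : 0 < θ) (hθ1 : θ < 1) (hC : 0 ≤ C) (hc : 0 ≤ c) (m : ℕ) :
    ∃ g₁₆ : ℝ, 0 < g₁₆ ∧ ∀ (g : ℝ) (rows : ℕ → ℕ → ℝ), 0 < g → g ≤ g₁₆ →
      (∀ K, ∃ (m' : ℕ) (g₀ : ℝ), rows K = S.cpl ⟨K, m', g₀⟩) → (∀ K, Step.InInterval γu K (rows K)) → (∀ K, rows K K = g) →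
      ∀ n : ℕ, gstar rows n = (fun x => solution (betaInf S.β) x 1)^[n] g := by
  have h1θ : 0 < 1 - θ := by linarith
  have hB := memoryProfile_betaInf hS hL' hΛ hθ0.le hθ1
  obtain ⟨gr, b, g₂, g₃, t, hgr, hb, hg₂, -, htbox, htflow, hprof, hmem, -⟩ :=
    reference_of_typedTheorem2 h hγu hrg hS hL' hΛ hθ0 hθ1 hC hc m
  have h2gr : 0 < 2 * gr := by positivity
  have h8C : 0 ≤ 8 * C := by positivity
  obtain ⟨e₀, he₀, hthr⟩ := flow_threshold_exists (1 / gr ^ 2 + C * γu / (1 - θ) ^ 2 + (2 * C / ((1 - θ) * b)) ^ 2) hC hθ1 hb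
  obtain ⟨e₁, he₁, hthr'⟩ := flow_threshold_exists (6 * (C * γu / (1 - θ) ^ 2 + (8 * C / ((1 - θ) * b)) ^ 2)) h8C hθ1 hb
  refine ⟨min e₀ (min e₁ (min (γu / 4) g₂)), lt_min he₀ (lt_min he₁ (lt_min (by positivity) hg₂)), fun g rows hg hle hrow hI hpin n => ?_⟩
  obtain ⟨hs1, hs2, hs4⟩ := hthr g hg (hle.trans (min_le_left _ _))
  obtain ⟨hs1', hs2', hs4'⟩ := hthr' g hg (hle.trans ((min_le_right _ _).trans (min_le_left _ _)))
  have h4g : 4 * g ≤ γu := by linarith [hle.trans ((min_le_right _ _).trans ((min_le_right _ _).trans (min_le_left _ _)))]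
  have hle2 : g ≤ g₂ := hle.trans ((min_le_right _ _).trans ((min_le_right _ _).trans (min_le_right _ _)))
  have h2g : 2 * g ≤ γu := by linarith
  obtain ⟨hbox, hflow⟩ := hmem rows g hrow hI hpin hle2
  have hgs : gstar rows = solution (betaInf S.β) g :=
    eq_solution_of_memFlow_of_reference hB hC hθ0.le hθ1 hb h2gr htbox htflow hprof hg h2g hs1 hs2 hs4 hbox hflow
  rw [hgs]
  exact solution_eq_orbit_of_reference hB hC hθ0.le hθ1 hb h2gr htbox htflow hprof hg h4g (by linarith) hs2 (by linarith) (by linarith) n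

/-! ## §39 Eventual RG-invariance along EVERY continuum trajectory of Theorem 2's rows — no smallness beyond existence -/

/-- **DEEP IN THE ULTRAVIOLET, EVERY CONTINUUM TRAJECTORY OF THEOREM 2's ROWS IS THE UNIQUE SOLUTION OF ITS OWN RE-PINNED FLOW — FROM THEOREM 2 AS TYPED, NO SMALLNESS
BEYOND EXISTENCE.**  `Theorem2Statement S hL` (a HYPOTHESIS), `hrg` on ]0, γ_u], NE4 + moduli (0 < θ < 1; γ_u ARBITRARY) ⟹ for every torus exponent m there is g₂ > 0 (part 6's
existence threshold, NOT shrunk further) such that for EVERY family `rows` of Theorem-2-type rows in ]0, γ_u] pinned at g_IR ≤ g₂ there is a physical scale n₀ with, for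
all n ≥ n₀: every box solution of `MemFlow (betaInf S.β) (gstar rows n) ·` is the tail `gstar rows (n + ·)`; node U2's `solution (betaInf S.β) (gstar rows n)` is that tail;
and node U2's lattice-free iterates from the constant history `gstar rows n` converge to it, `iterate (betaInf S.β) (gstar rows n) k m′ → gstar rows (n + m′)` — part 25's
`eventually_wellPosed_tail` for the AF box solution `gstar rows` (part 6: profile `1∕(4g_IR²) + b·m′`). [cite: Balaban1987RG1, Thm 2 (0.31) p.259 with (0.20) p.256 and §5 p.298] -/
theorem eventually_wellPosed_of_typedTheorem2 {hL : Odd S.L ∧ 1 < S.L} (h : Theorem2Statement S hL)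
    {γu θ C c : ℝ} {Λ : ℕ → ℕ → ℝ} (hγu : 0 < γu)
    (hrg : ∀ P : B12.RunParams, Step.InInterval γu P.K (S.cpl P) → RGEqH P.K S.β (S.cpl P))
    (hS : ScaleShiftRate c θ γu S.β) (hL' : HistLipschitz Λ γu S.β) (hΛ : FadingMemory C θ Λ)
    (hθ0 : 0 < θ) (hθ1 : θ < 1) (hC : 0 ≤ C) (hc : 0 ≤ c) (m : ℕ) :
    ∃ g₂ : ℝ, 0 < g₂ ∧ ∀ (rows : ℕ → ℕ → ℝ) (gIR : ℝ),
      (∀ K, ∃ (m' : ℕ) (g₀ : ℝ), rows K = S.cpl ⟨K, m', g₀⟩) → (∀ K, Step.InInterval γu K (rows K)) → (∀ K, rows K K = gIR) → gIR ≤ g₂ →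
      ∃ n₀ : ℕ, ∀ n, n₀ ≤ n →
        (∀ h' : ℕ → ℝ, SeqBox γu h' → MemFlow (betaInf S.β) (gstar rows n) h' → h' = fun j => gstar rows (n + j)) ∧
        (solution (betaInf S.β) (gstar rows n) = fun j => gstar rows (n + j)) ∧
        ∀ m' : ℕ, Tendsto (fun k => iterate (betaInf S.β) (gstar rows n) k m') atTop (𝓝 (gstar rows (n + m'))) := by
  have hB := memoryProfile_betaInf hS hL' hΛ hθ0.le hθ1
  obtain ⟨g₂, hg₂, hmem⟩ := memFlow_bigBox_of_typedTheorem2 h hγu hrg hS hL' hΛ hθ0 hθ1 hC hc m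
  obtain ⟨g₂', b, b', hg₂', hb, -, hall⟩ := continuumCoupling_bigBox_of_typedTheorem2 h hγu hrg hS hL' hΛ hθ0 hθ1 hC hc m
  refine ⟨min g₂ g₂', lt_min hg₂ hg₂', fun rows gIR hrow hI hpin hle => ?_⟩
  obtain ⟨hinj, hbox, hflow⟩ := hmem rows gIR hrow hI hpin (hle.trans (min_le_left _ _))
  obtain ⟨-, -, -, -, -, -, -, hprofr, -⟩ := hall rows gIR hrow hI hpin (hle.trans (min_le_right _ _))
  have hgIR : 0 < gIR := by rw [← hpin 0]; exact ((hI 0) 0 le_rfl).1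
  have h2gIR : 0 < 2 * gIR := by positivity
  have hboxr : ∀ K i, i ≤ K → 0 < rows K i ∧ rows K i ≤ γu := fun K => hI K
  have hprof : ∀ m' : ℕ, 1 / (2 * gIR) ^ 2 + b * (m' : ℝ) ≤ 1 / (gstar rows m') ^ 2 := by
    intro m'
    rw [T4ContinuumCoupling.one_div_gstar_sq hθ1 hinj hboxr m']
    have e1 : 1 / (2 * gIR) ^ 2 = 1 / (4 * gIR ^ 2) := by ring
    rw [e1]
    exact (hprofr m').1
  obtain ⟨n₀, hn₀⟩ := eventually_wellPosed_tail hB hC hθ0.le hθ1 hb h2gIR hbox hflow hprof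
  exact ⟨n₀, hn₀⟩

end

end Summit.QuantumFields.BalabanUV.Beta.EriceFlowEnclosureB12AsPrintedHistoryContagionShiftFlowRepinEnd
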